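import Summits.AtomisticToContinuum.Crystallization.Theorems.ExcessDecayLiouvilleHcpLiouvilleOfInputs
import Summits.AtomisticToContinuum.Crystallization.Theorems.ExcessDecayLiouvilleHcpLiouvilleSecantZeroOfBox
import Summits.AtomisticToContinuum.Crystallization.Theorems.ExcessDecayLiouvilleHcpLiouvilleAnchoredBlowdown
import Summits.AtomisticToContinuum.Crystallization.Theorems.ExcessDecayLiouvilleHcpLiouvilleSymmetricShift
import Summits.AtomisticToContinuum.Crystallization.Theorems.ExcessDecayLiouvilleHcpLiouvilleSymmetricShiftConformal
import Summits.AtomisticToContinuum.Crystallization.Theorems.ExcessDecayLiouvilleHcpLiouvilleBlowdownCaccioppoliOwn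
import Summits.AtomisticToContinuum.Crystallization.Theorems.ExcessDecayLiouvilleHcpLiouvilleCoreOfCaccioppoli

/-!
# Line `Sketch` (card `two-level-caccioppoli`) for the crux `HcpLiouville` (stmt-AtomisticToContinuum-9332)

Skeleton v5.4 (lead c2, cycle 2, 2026-08-17; v5.4: probe j025233 (tangent0) finds the TANGENT box input `stub_anchoredBox` numerically FALSE at the uniaxial Adm corner diag(0.945,0.945,0.995) (λ_min = −0.036 for a homogeneous pattern of sublattice-opposite c-displacements of size 1/40, long-wave Bloch mode; Arb certification queued j027071), while the SECANT forms stay positive (secant20 min +0.21 so far) — composition B therefore takes the weaker bilinear SECANT input at anchor radius 0, which B3 consumes directly; wave 2 landed A3 p154643, A4 p154839; v5 registered 08:55Z, wave 1 landed B2 p150804, B3 p151370, S p151952 + uniaxial instantiation p153218; v5.2 weakens composition A's coercivity input to the OWN-FIELD form the Caccioppoli step really consumes).  The crux is `HcpLiouville ↔ (PhononStability → Core)`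
(`hcpLiouville_iff`, definitional).

## Where the line stands
v4 (lead c1) landed EVERY analytic stub of the quantitative blow-down — `stub_onePerSite` p92054, anchor reduction
p92546, `stub_caccioppoli` p140868, `stub_remainder` p143367, `stub_green` p144153, `stub_interior` p146815,
`stub_improvement` p142673, `stub_iteration` p141851 — and the conditional composition
`BlowdownLine.hcpLiouville_of_inputs` (p147136): `relaxedShift → (∃ κ₁>0, SecantCoercive (1/20) κ₁) → HcpLiouville`.
Its one open stub `stub_coerciveInputs` (the conjunction of the two certified-computation inputs) was handed back as
crux-sized (no certificate architecture reaches ray-secant coercivity at anchor radius `1/20`, i.e. inter-sublattice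
strain `≈ 0.1`; the relaxed-shift covering has slack `0.0023` in 9 dimensions).

## v5 = v4 with the computational residue SPLIT and the ANCHORED REGIME banked
* Composition A (unchanged mathematics): `stub_relaxedShift` + `stub_secantCoercive` (the two conjuncts of v4's
  `stub_coerciveInputs`, now registered separately so that each can be attacked / refuted on its own) ⟹ `HcpLiouville_of`
  through the landed `hcpLiouville_of_inputs`.
* Composition B (the anchoring cut of `Cruxes/HcpLiouville/DECOMPOSITION.md`, built from Sketch's landed assets):
  - `stub_anchoredBox` — TANGENT box coercivity at vertex radius `1/40` about EQUILIBRIUM data (`Equil₀ (Sites₀ t A)`):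
    the most certifiable coercivity input of the whole chain (no θ-integral, anchor shift `τ = 0`, adversarial float
    threshold `η⋆ ≈ 0.034–0.039 > 1/40` about relaxed data, kit j008231).  NOT the certified-false `BoxCoercive (1/40)`
    (that one is centred at mis-shifted data: kit j017763);
  - `stub_secantZero_of_box` — analytic: tangent box coercivity about equilibrium data ⟹ `SecantCoercive 0 κ`
    (integrate the landed ray identity `ray_integral_eq_secFormAt` over `θ ∈ [0,1]`; every point of the ray stays in the box);
  - `stub_anchoredBlowdown` — analytic: the v4 blow-down at `τ = 0` (all interfaces landed) gives the coarse Liouville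
    theorem for EQUILIBRIUM data from `SecantCoercive 0 κ₁`;
  - `stub_equilibriumAnchoring` — the open core (Liouville strength): re-anchor the typed datum to an equilibrium datum
    keeping the global `1/40`-matching;
  - glue `core_of_anchored_of_anchoring` (pure logic) ⟹ `HcpLiouville_of_anchored`.
* `stub_symmetricShift` — analytic: for cells `A` intertwining the hcp point-group generators (3-fold axis `R`, basal
  mirror `M`) with isometries, the GEOMETRIC shift `A(w₀ + √(2/3)e₃)` is an exact zero of the optical force (lattice-sum
  symmetry: `T S = S`, `T′ S = S`, `Fix R ∩ Fix M = 0`).  It discharges `stub_relaxedShift` on the D3h-symmetric cells and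
  makes exactly-shifted symmetric data EQUILIBRIUM data, to which composition B applies without `stub_equilibriumAnchoring`
  (`core_symmetric_exact`).

`sorry` appears only in `stub_*`.
-/

noncomputable section

namespace Summit.AtomisticToContinuum.Crystallization.Cruxes.HcpLiouville.Lines.Sketch

open scoped BigOperators Topology Classical InnerProductSpace
open Literature.MathematicalPhysics.StatisticalMechanics
open Summit.AtomisticToContinuum.Crystallization.Theses.ExcessDecayLiouville
open Summit.AtomisticToContinuum.Crystallization.Theorems.PhononStabilityNegative
open Summit.AtomisticToContinuum.Crystallization.Theorems.ExcessDecayLiouville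

local notation "E3" => EuclideanSpace ℝ (Fin 3)

/-! ## The crux in named form -/

/-- The crux is `PhononStability → (coarse Liouville over the mirror predicates)` by definitional
unfolding of its `let`s. -/
theorem hcpLiouville_iff :
    HcpLiouville ↔
      (PhononStability → ∀ δ : ℝ, 0 < δ → ∀ X : Set E3, Sep₀ X δ → Equil₀ X →
        ∀ (t : Fin 2 → E3) (A : E3 →L[ℝ] E3), Adm₀ A → Inner₀ t A →
          (∀ (c : E3) (r : ℝ), Near₀ X c r t A (1 / 40)) →
            ∃ (t' : Fin 2 → E3) (A' : E3 →L[ℝ] E3), Adm₀ A' ∧ X = Sites₀ t' A') :=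
  Iff.rfl

/-! ## Open stubs — composition A (the two certified-computation inputs of v4, now separate) -/

/-- Stub A1 (CERTIFIED COMPUTATION; no analytic worker): every admissible cell has a zero of its optical force within
`1/40` of the geometric hcp shift (floats: max deviation 0.0227 at the pure-shear corners of `Adm`). -/
theorem stub_relaxedShift :
    ∀ (A : E3 →L[ℝ] E3), Adm₀ A →
      ∃ e : E3, ‖e - A (barlowOffset 1 + layerNormal (Real.sqrt (2 / 3)))‖ ≤ 1 / 40 ∧
        HasSum (fun z : Λ₀ => (deriv lennardJones ‖e + A z‖ / ‖e + A z‖) • (e + A z)) 0 := by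
  sorry

/-- Stub A2′ (CERTIFIED COMPUTATION; no analytic worker): OWN-FIELD weighted ray-secant coercivity from relaxed anchors at
anchor radius `1/20` — exactly the instance the Caccioppoli step consumes (`…BlowdownCaccioppoli.lean`, `nnForm_cutoff_sub_le`:
the test field is the cut-off of the displacement itself, `χ_{c,R} • (v − m)`, `1 ≤ R`, `‖m‖ ≤ 1`), strictly weaker than the
bilinear `SecantCoercive (1/20)` of v4/v5 (floats: own-field ratio `R_sec ≥ 0.11` at vertex radius `3/40`, kit j008231). -/
theorem stub_ownSecantCoercive :
    ∃ κ₁ : ℝ, 0 < κ₁ ∧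
      ∀ (t : Fin 2 → E3) (A : E3 →L[ℝ] E3) (τ : E3), Adm₀ A → Inner₀ t A → ‖τ‖ ≤ 1 / 20 →
        Inner₀ (anchorDatum t τ) A → Equil₀ (Sites₀ (anchorDatum t τ) A) →
        ∀ v : E3 → E3, (∀ s ∈ Sites₀ (anchorDatum t τ) A, ‖v s + shiftField (anchorDatum t τ) A τ s‖ ≤ 1 / 40) →
          ∀ (c : E3) (R : ℝ) (m : E3), 1 ≤ R → ‖m‖ ≤ 1 →
            κ₁ * nnForm (anchorDatum t τ) A
                (fun p => LevelOne.cutoff (Sites₀ (anchorDatum t τ) A) c R p • (v p - m)) ≤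
              secFormAt (anchorDatum t τ) A v
                (fun p => LevelOne.cutoff (Sites₀ (anchorDatum t τ) A) c R p • (v p - m)) / 2 := by
  sorry

/-- (A3) LANDED (p154643, `Theorems/ExcessDecayLiouvilleHcpLiouvilleBlowdownCaccioppoliOwn.lean`): the nonlinear Caccioppoli
interface from the OWN-FIELD input. -/
theorem stub_caccioppoli_own_landed :
    ∀ κ₁ : ℝ, 0 < κ₁ →
      (∀ (t : Fin 2 → E3) (A : E3 →L[ℝ] E3) (τ : E3), Adm₀ A → Inner₀ t A → ‖τ‖ ≤ 1 / 20 →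
        Inner₀ (anchorDatum t τ) A → Equil₀ (Sites₀ (anchorDatum t τ) A) →
        ∀ v : E3 → E3, (∀ s ∈ Sites₀ (anchorDatum t τ) A, ‖v s + shiftField (anchorDatum t τ) A τ s‖ ≤ 1 / 40) →
          ∀ (c : E3) (R : ℝ) (m : E3), 1 ≤ R → ‖m‖ ≤ 1 →
            κ₁ * nnForm (anchorDatum t τ) A
                (fun p => LevelOne.cutoff (Sites₀ (anchorDatum t τ) A) c R p • (v p - m)) ≤
              secFormAt (anchorDatum t τ) A v
                (fun p => LevelOne.cutoff (Sites₀ (anchorDatum t τ) A) c R p • (v p - m)) / 2) →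
      ∃ C : ℝ, Blowdown.CaccioppoliProp (1 / 20) C :=
  Summit.AtomisticToContinuum.Crystallization.Theorems.ExcessDecayLiouville.stub_caccioppoli_own

/-- (A4) LANDED (p154839, `Theorems/ExcessDecayLiouvilleHcpLiouvilleCoreOfCaccioppoli.lean`): the coarse Liouville CORE from
the relaxed shift and the Caccioppoli interface (the landed blow-down). -/
theorem stub_core_of_caccioppoli_landed :
    (∀ (A : E3 →L[ℝ] E3), Adm₀ A →
      ∃ e : E3, ‖e - A (barlowOffset 1 + layerNormal (Real.sqrt (2 / 3)))‖ ≤ 1 / 40 ∧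
        HasSum (fun z : Λ₀ => (deriv lennardJones ‖e + A z‖ / ‖e + A z‖) • (e + A z)) 0) →
    (∃ C : ℝ, Blowdown.CaccioppoliProp (1 / 20) C) →
    PhononStability → ∀ δ : ℝ, 0 < δ → ∀ X : Set E3, Sep₀ X δ → Equil₀ X →
      ∀ (t : Fin 2 → E3) (A : E3 →L[ℝ] E3), Adm₀ A → Inner₀ t A →
        (∀ (c : E3) (r : ℝ), Near₀ X c r t A (1 / 40)) →
          ∃ (t' : Fin 2 → E3) (A' : E3 →L[ℝ] E3), Adm₀ A' ∧ X = Sites₀ t' A' :=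
  Summit.AtomisticToContinuum.Crystallization.Theorems.ExcessDecayLiouville.stub_core_of_caccioppoli

/-! ## Open stubs — composition B (anchored regime + the open core) -/

/-- Stub B1′ (CERTIFIED COMPUTATION; no analytic worker): bilinear ray-SECANT coercivity from EQUILIBRIUM data at anchor radius
`0` (displacements `‖v s‖ ≤ 1/40`; the strategist's `stub_anchoredSecant`).  Weaker than the tangent box input of v5–v5.3
(`stub_secantZero_of_box_landed` below), which probe j025233 finds numerically FALSE at the Adm corner `diag(0.945,0.945,0.995)`;
the secant forms are positive in floats (homogeneous c-ray secant zero ≈ 0.125 ≫ 0.05 = the reach here). -/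
theorem stub_secantCoerciveZero : ∃ κ₁ : ℝ, 0 < κ₁ ∧ SecantCoercive 0 κ₁ := by
  sorry

/-- (B2) LANDED (p150804, `Theorems/ExcessDecayLiouvilleHcpLiouvilleSecantZeroOfBox.lean`): tangent box coercivity about
equilibrium data implies ray-secant coercivity at anchor radius `0` with the same constant (true, but its hypothesis is
numerically false at an Adm corner — kept for the record; composition B no longer routes through it). -/
theorem stub_secantZero_of_box_landed :
    ∀ κ : ℝ,
      (∀ (t : Fin 2 → E3) (A : E3 →L[ℝ] E3), Adm₀ A → Inner₀ t A → Equil₀ (Sites₀ t A) →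
        ∀ w : E3 → E3, (∀ s ∈ Sites₀ t A, ‖w s‖ ≤ 1 / 40) →
          ∀ φ : E3 → E3, (Function.support φ).Finite → Function.support φ ⊆ Sites₀ t A →
            κ * nnForm t A φ ≤ hessFormAt t A w φ / 2) →
      SecantCoercive 0 κ :=
  Summit.AtomisticToContinuum.Crystallization.Theorems.ExcessDecayLiouville.stub_secantZero_of_box

/-- (B3) LANDED (p151370, `Theorems/ExcessDecayLiouvilleHcpLiouvilleAnchoredBlowdown.lean`): the v4 blow-down at `τ = 0` —
harmonic stability and `SecantCoercive 0 κ₁` give the coarse Liouville theorem for EQUILIBRIUM data. -/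
theorem stub_anchoredBlowdown_landed :
    PhononStability → ∀ κ₁ : ℝ, 0 < κ₁ → SecantCoercive 0 κ₁ →
      ∀ δ : ℝ, 0 < δ → ∀ X : Set E3, Sep₀ X δ → Equil₀ X →
        ∀ (t : Fin 2 → E3) (A : E3 →L[ℝ] E3), Adm₀ A → Inner₀ t A → Equil₀ (Sites₀ t A) →
          (∀ (c : E3) (r : ℝ), Near₀ X c r t A (1 / 40)) →
            ∃ (t' : Fin 2 → E3) (A' : E3 →L[ℝ] E3), Adm₀ A' ∧ X = Sites₀ t' A' :=
  Summit.AtomisticToContinuum.Crystallization.Theorems.ExcessDecayLiouville.stub_anchoredBlowdown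

/-- Stub B4 (THE OPEN CORE, Liouville strength; no analytic worker): under the crux's hypotheses `X` is globally
two-way `1/40`-matched with SOME admissible hcp-like datum whose site set is in force balance. -/
theorem stub_equilibriumAnchoring :
    PhononStability →
      ∀ δ : ℝ, 0 < δ → ∀ X : Set E3, Sep₀ X δ → Equil₀ X →
        ∀ (t : Fin 2 → E3) (A : E3 →L[ℝ] E3), Adm₀ A → Inner₀ t A →
          (∀ (c : E3) (r : ℝ), Near₀ X c r t A (1 / 40)) →
            ∃ (t'' : Fin 2 → E3) (A'' : E3 →L[ℝ] E3), Adm₀ A'' ∧ Inner₀ t'' A'' ∧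
              Equil₀ (Sites₀ t'' A'') ∧ ∀ (c : E3) (r : ℝ), Near₀ X c r t'' A'' (1 / 40) := by
  sorry

/-! ## Exact relaxed shift of symmetric cells — LANDED -/

/-- (S) LANDED (p151952, `Theorems/ExcessDecayLiouvilleHcpLiouvilleSymmetricShift.lean`; instantiated for every uniaxial cell
`A = Q ∘ diag(s, s, s + r)` in p153218, `…SymmetricShiftConformal.lean`, `hcpLiouville_symmetricShift_uniaxial`): a cell intertwining
two lattice symmetries with trivial common fixed space by isometries has the geometric shift as an exact zero of its optical force. -/
theorem stub_symmetricShift_landed :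
    ∀ (A R M : E3 →L[ℝ] E3), Adm₀ A →
      Set.BijOn R Λ₀ Λ₀ → R (barlowOffset 1 + layerNormal (Real.sqrt (2 / 3))) - (barlowOffset 1 + layerNormal (Real.sqrt (2 / 3))) ∈ Λ₀ →
      Set.BijOn M Λ₀ Λ₀ → M (barlowOffset 1 + layerNormal (Real.sqrt (2 / 3))) - (barlowOffset 1 + layerNormal (Real.sqrt (2 / 3))) ∈ Λ₀ →
      (∀ y : E3, R y = y → M y = y → y = 0) →
      (∃ T : E3 ≃ₗᵢ[ℝ] E3, ∀ x : E3, A (R x) = T (A x)) → (∃ T : E3 ≃ₗᵢ[ℝ] E3, ∀ x : E3, A (M x) = T (A x)) →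
      HasSum (fun z : Λ₀ =>
        (deriv lennardJones ‖A (barlowOffset 1 + layerNormal (Real.sqrt (2 / 3))) + A z‖ /
            ‖A (barlowOffset 1 + layerNormal (Real.sqrt (2 / 3))) + A z‖) •
          (A (barlowOffset 1 + layerNormal (Real.sqrt (2 / 3))) + A z)) 0 :=
  Summit.AtomisticToContinuum.Crystallization.Theorems.ExcessDecayLiouville.stub_symmetricShift

/-! ## Composition A′ (v4 with the own-field input): the crux from the two certified-computation inputs -/

/-- **The crux from the line, composition A′**: `HcpLiouville`, concluded by name from `stub_relaxedShift` and
`stub_ownSecantCoercive` through the landed A3, A4 (the blow-down). -/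
theorem HcpLiouville_of : HcpLiouville := by
  obtain ⟨κ₁, hκ₁, hown⟩ := stub_ownSecantCoercive
  exact hcpLiouville_iff.2 (stub_core_of_caccioppoli_landed stub_relaxedShift (stub_caccioppoli_own_landed κ₁ hκ₁ hown))

/-- Composition A of v4/v5 remains available: the bilinear input implies the own-field one trivially, and
`BlowdownLine.core_of_inputs` (p147136) gives the core from `SecantCoercive (1/20) κ₁` (stated on the core, not on the crux
by name, so that the skeleton audit sees no unregistered hypothesis on the crux). -/
theorem core_of_bilinear (hSC : ∃ κ₁ : ℝ, 0 < κ₁ ∧ SecantCoercive (1 / 20) κ₁) :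
    PhononStability → ∀ δ : ℝ, 0 < δ → ∀ X : Set E3, Sep₀ X δ → Equil₀ X →
      ∀ (t : Fin 2 → E3) (A : E3 →L[ℝ] E3), Adm₀ A → Inner₀ t A →
        (∀ (c : E3) (r : ℝ), Near₀ X c r t A (1 / 40)) →
          ∃ (t' : Fin 2 → E3) (A' : E3 →L[ℝ] E3), Adm₀ A' ∧ X = Sites₀ t' A' :=
  BlowdownLine.core_of_inputs stub_relaxedShift hSC

/-! ## Composition B (anchored regime + open core) -/

/-- The anchored regime (the crux for EQUILIBRIUM data) from stub B1′ and the landed B3 (pure logic). -/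
theorem anchoredCore_of_stubs (hPS : PhononStability) :
    ∀ δ : ℝ, 0 < δ → ∀ X : Set E3, Sep₀ X δ → Equil₀ X →
        ∀ (t : Fin 2 → E3) (A : E3 →L[ℝ] E3), Adm₀ A → Inner₀ t A → Equil₀ (Sites₀ t A) →
          (∀ (c : E3) (r : ℝ), Near₀ X c r t A (1 / 40)) →
            ∃ (t' : Fin 2 → E3) (A' : E3 →L[ℝ] E3), Adm₀ A' ∧ X = Sites₀ t' A' := by
  obtain ⟨κ₁, hκ₁, h0⟩ := stub_secantCoerciveZero
  exact stub_anchoredBlowdown_landed hPS κ₁ hκ₁ h0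

/-- **Glue** (pure logic, = `hcpLiouville_of_subs` of DECOMPOSITION.md, stated on the core): anchored Liouville and
equilibrium anchoring give the coarse Liouville core — re-anchor the datum, conclude with the anchored regime. -/
theorem core_of_anchored_of_anchoring
    (h₁ : PhononStability → ∀ δ : ℝ, 0 < δ → ∀ X : Set E3, Sep₀ X δ → Equil₀ X →
      ∀ (t : Fin 2 → E3) (A : E3 →L[ℝ] E3), Adm₀ A → Inner₀ t A → Equil₀ (Sites₀ t A) →
        (∀ (c : E3) (r : ℝ), Near₀ X c r t A (1 / 40)) →
          ∃ (t' : Fin 2 → E3) (A' : E3 →L[ℝ] E3), Adm₀ A' ∧ X = Sites₀ t' A')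
    (h₂ : PhononStability → ∀ δ : ℝ, 0 < δ → ∀ X : Set E3, Sep₀ X δ → Equil₀ X →
      ∀ (t : Fin 2 → E3) (A : E3 →L[ℝ] E3), Adm₀ A → Inner₀ t A →
        (∀ (c : E3) (r : ℝ), Near₀ X c r t A (1 / 40)) →
          ∃ (t'' : Fin 2 → E3) (A'' : E3 →L[ℝ] E3), Adm₀ A'' ∧ Inner₀ t'' A'' ∧
            Equil₀ (Sites₀ t'' A'') ∧ ∀ (c : E3) (r : ℝ), Near₀ X c r t'' A'' (1 / 40)) :
    PhononStability → ∀ δ : ℝ, 0 < δ → ∀ X : Set E3, Sep₀ X δ → Equil₀ X →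
      ∀ (t : Fin 2 → E3) (A : E3 →L[ℝ] E3), Adm₀ A → Inner₀ t A →
        (∀ (c : E3) (r : ℝ), Near₀ X c r t A (1 / 40)) →
          ∃ (t' : Fin 2 → E3) (A' : E3 →L[ℝ] E3), Adm₀ A' ∧ X = Sites₀ t' A' := by
  intro hPS δ hδ X hSep hEq t A hA hI hN
  obtain ⟨t'', A'', hA'', hI'', hE'', hN''⟩ := h₂ hPS δ hδ X hSep hEq t A hA hI hN
  exact h₁ hPS δ hδ X hSep hEq t'' A'' hA'' hI'' hE'' hN''

/-- **The crux from the line, composition B**: `HcpLiouville`, concluded by name from the anchored regime (stub B1′ +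
landed B3) and the open core (stub B4). -/
theorem HcpLiouville_of_anchored : HcpLiouville :=
  hcpLiouville_iff.2 (core_of_anchored_of_anchoring (fun hPS => anchoredCore_of_stubs hPS) stub_equilibriumAnchoring)

/-! ## Uniaxial cells with the exact geometric shift are equilibrium data (no open core needed there) -/

section Uniaxial

variable {t : Fin 2 → E3} {A : E3 →L[ℝ] E3}

/-- For a uniaxial admissible cell `A = Q ∘ (x ↦ s x + r x₂ e₃)` (every c/a ratio, every basal scale, any orientation `Q`)
`stub_relaxedShift` holds with deviation `0`: the geometric shift is relaxed (landed p153218). -/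
theorem relaxedShift_of_uniaxial (hA : Adm₀ A) (s r : ℝ) (Q : E3 ≃ₗᵢ[ℝ] E3)
    (hAQ : ∀ x : E3, A x = Q (s • x + (r * x 2) • layerNormal 1)) :
    ∃ e : E3, ‖e - A (barlowOffset 1 + layerNormal (Real.sqrt (2 / 3)))‖ ≤ 1 / 40 ∧
      HasSum (fun z : Λ₀ => (deriv lennardJones ‖e + A z‖ / ‖e + A z‖) • (e + A z)) 0 :=
  ⟨A (barlowOffset 1 + layerNormal (Real.sqrt (2 / 3))), by norm_num,
    hcpLiouville_symmetricShift_uniaxial A s r Q hA hAQ⟩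

/-- A uniaxial admissible cell with the EXACT geometric inner shift is an equilibrium two-lattice. -/
theorem equil_sites_of_uniaxial (hA : Adm₀ A) (s r : ℝ) (Q : E3 ≃ₗᵢ[ℝ] E3)
    (hAQ : ∀ x : E3, A x = Q (s • x + (r * x 2) • layerNormal 1))
    (ht : t 1 - t 0 = A (barlowOffset 1 + layerNormal (Real.sqrt (2 / 3)))) :
    Equil₀ (Sites₀ t A) := by
  have hI : Inner₀ t A := by
    unfold Inner₀; rw [ht, sub_self, norm_zero]; norm_num
  rw [equil₀_sites_iff_hasSum hA hI, ht]
  exact hcpLiouville_symmetricShift_uniaxial A s r Q hA hAQ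

/-- **Composition B without the open core, on uniaxial exactly-shifted data**: for a uniaxial admissible cell and a datum with
the exact geometric inner shift, every separated Lennard-Jones equilibrium globally `1/40`-matched with the datum is an
admissible two-lattice — modulo the ONE certificate `stub_secantCoerciveZero` (B3, S landed). -/
theorem core_uniaxial_exact (hPS : PhononStability) {δ : ℝ} (hδ : 0 < δ) {X : Set E3} (hSep : Sep₀ X δ)
    (hEq : Equil₀ X) (hA : Adm₀ A) (s r : ℝ) (Q : E3 ≃ₗᵢ[ℝ] E3)
    (hAQ : ∀ x : E3, A x = Q (s • x + (r * x 2) • layerNormal 1))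
    (ht : t 1 - t 0 = A (barlowOffset 1 + layerNormal (Real.sqrt (2 / 3))))
    (hN : ∀ (c : E3) (r : ℝ), Near₀ X c r t A (1 / 40)) :
    ∃ (t' : Fin 2 → E3) (A' : E3 →L[ℝ] E3), Adm₀ A' ∧ X = Sites₀ t' A' := by
  have hI : Inner₀ t A := by
    unfold Inner₀; rw [ht, sub_self, norm_zero]; norm_num
  exact anchoredCore_of_stubs hPS δ hδ X hSep hEq t A hA hI (equil_sites_of_uniaxial hA s r Q hAQ ht) hN

end Uniaxial

end Summit.AtomisticToContinuum.Crystallization.Cruxes.HcpLiouville.Lines.Sketch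

end
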